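import Literature.NumberTheory.EllipticCurves.LatticeEndomorphism
import Literature.NumberTheory.EllipticCurves.LatticeMultiplierIndex
import Literature.NumberTheory.EllipticCurves.WeierstrassTransformationFive
import Literature.NumberTheory.EllipticCurves.WeierstrassTorsion
import Literature.NumberTheory.EllipticCurves.RealLatticePeriodHalfPeriodsProofs
import Mathlib.Analysis.Complex.Cardinality
import HarnessLib

/-!
# The transformation polynomials of a complex multiplication exist:
# `αΛ ⊆ Λ ⇒ ℘(αz) = (P/Q)(℘(z))` with `(P, Q)` satisfying `(H1)`, `(H2)`

Topic `NumberTheory/EllipticCurves`; a proofs-only file (theorems only, no definitions, no named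
facts) in `namespace PeriodPair` (deliberate dot-notation extensions of Mathlib's `PeriodPair`, as
in `LatticeEndomorphism.lean`).  That file proves the *converse* direction of the classical
equivalence "`Λ` has complex multiplication by `α` iff `℘(αz)` is a rational function of `℘(z)`"
(Cox, *Primes of the form x² + ny²*, Thm. 10.14 (ii) ⇔ (iii); Weber, *Lehrbuch der Algebra* III
§§ 114–115): a pair `P, Q ∈ ℂ[X]`, `Q ≠ 0`, satisfying the polynomial identities
`(H1)` `f·(P'Q − PQ')² = α²(4P³ − g₂PQ² − g₃Q³)Q` and
`(H2)` `2[(P''Q − PQ'')Q − 2Q'(P'Q − PQ')]f + (P'Q − PQ')Q(12X² − g₂) = α²(12P²Q − g₂Q³)`,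
`f = 4X³ − g₂X − g₃`, forces `αΛ ⊆ Λ` (`PeriodPair.mul_mem_lattice_of_transformation`).  Here we
prove the **direct** direction, in the same polynomial form:

* `PeriodPair.exists_transformation_of_mul_mem_lattice` — if `α ≠ 0` and `αΛ ⊆ Λ`, there are
  `P, Q ∈ ℂ[X]`, `Q ≠ 0`, satisfying `(H1)` and `(H2)` with `g₂ = g₂(Λ)`, `g₃ = g₃(Λ)`.

Since `(H1)`, `(H2)` are identities of polynomials whose only parameters are `α`, `g₂`, `g₃` and the
coefficients of `P, Q`, this makes "`Λ` has complex multiplication by `α`" a statement that can be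
transported along any field automorphism of `ℂ` — the use made of `℘(αz) = A(℘)/B(℘)` in Cox's
proof of Thm. 10.23 ((10.24)–(10.25)), which is what this file serves.

## The proof (Cox §10.B–C; Lawden §9.8; Whittaker–Watson §20.3)

1. `exists_reps_of_mul_mem` — a system of representatives `S ∋ 0` of `α⁻¹Λ/Λ`, chosen among the
   division points `(iω₁ + jω₂)/N`, `0 ≤ i, j < N`, `N = [Λ : αΛ]` (the tree's
   `PeriodPair.natCard_mul_mem_lattice_of_mul_mem`: `αz ∈ Λ ⇒ Nz ∈ Λ`).
2. `weierstrassP_mul_eq_sum_sub` — the transformation of order `N` (tree: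
   `PeriodPair.weierstrassP_transformation`, Lawden (9.8.14)) for `α⁻¹Λ ⊇ Λ` together with the
   homogeneity `℘_{α⁻¹Λ}(z) = α²℘_Λ(αz)`: `α²℘(αz) = Σ_{c ∈ S} ℘(z − c) − Σ_{c ≠ 0} ℘(c)` off
   `α⁻¹Λ`; since the left side is even, `Σ_c ℘(z + c) = Σ_c ℘(z − c)` (`sum_weierstrassP_add_eq`).
3. `exists_rationalMap_of_mul_mem` — hence `2α²℘(αz) = 2℘(z) + Σ_{c ≠ 0} [℘(z + c) + ℘(z − c)]
   − 2K`, and each bracket is the rational function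
   `(2e x² + (2e² − g₂/2)x − (g₂e/2 + g₃))/(x − e)²` of `x = ℘(z)`, `e = ℘(c)` (symmetric addition
   formula, tree `PeriodPair.weierstrassP_add_add_weierstrassP_sub`, Whittaker–Watson Ex. 20.3.3):
   `℘(αz) = P(℘ z)/Q(℘ z)` with `Q = ∏_{c ≠ 0} (X − ℘(c))²`, off `α⁻¹Λ` (where `Q(℘ z) ≠ 0`).
4. `transformation_identities_of_rationalMap` — differentiating `℘(αz) = (P/Q)(℘ z)` once and
   twice along the ODE `℘'' = 6℘² − g₂/2`, `℘'² = f(℘)` (the computations of `LatticeEndomorphism.lean`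
   read backwards) gives `(H1)` and `(H2)` *evaluated at* `℘(z)` for all `z ∉ α⁻¹Λ`; as `℘` takes all
   but countably many values there, the polynomial identities follow
   (`eq_zero_of_eval_weierstrassP_eq_zero`).

## References

* D. A. Cox, *Primes of the form x² + ny²*, 2nd ed., Wiley 2013, §10.B Thm. 10.14 and its proof,
  §10.C (10.24)–(10.25) (PDF pp. 219–226 of the held copy). [Cox2013]
* D. F. Lawden, *Elliptic Functions and Applications*, Springer 1989, §9.8. [Lawden1989]
* E. T. Whittaker, G. N. Watson, *A Course of Modern Analysis*, 4th ed., CUP 1927, §20.3,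
  Example 20.3.3. [WhittakerWatson1927]
* H. Weber, *Lehrbuch der Algebra*, Bd. III, 2. Aufl., Vieweg 1908, §§ 114–115.
-/

noncomputable section

open Complex Filter Topology Set Polynomial

namespace PeriodPair

variable (L : PeriodPair) {α : ℂ}

/-! ### A system of representatives of `α⁻¹Λ/Λ` among the division points -/

/-- **Representatives of `α⁻¹Λ/Λ`.**  If `α ≠ 0` and `αΛ ⊆ Λ` there is a finite set `S ∋ 0` of
complex numbers, pairwise incongruent modulo `Λ`, with `αx ∈ Λ ↔ x ≡ c (mod Λ)` for some `c ∈ S`: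
the division points `(iω₁ + jω₂)/N`, `0 ≤ i, j < N`, `N = [Λ : αΛ]`, with `αc ∈ Λ`
(`N·α⁻¹Λ ⊆ Λ`, `PeriodPair.natCard_mul_mem_lattice_of_mul_mem`). [folklore] -/
theorem exists_reps_of_mul_mem (hα0 : α ≠ 0) (hα : ∀ l ∈ L.lattice, α * l ∈ L.lattice) :
    ∃ S : Finset ℂ, (0 : ℂ) ∈ S ∧ (∀ x, α * x ∈ L.lattice ↔ ∃ c ∈ S, x - c ∈ L.lattice) ∧
      ∀ c ∈ S, ∀ c' ∈ S, c - c' ∈ L.lattice → c = c' := by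
  classical
  set N := Nat.card (L.lattice ⧸ LinearMap.range ((LinearMap.mulLeft ℤ α).restrict hα)) with hN
  have hN0 : N ≠ 0 := L.natCard_quotient_range_mulLeft_ne_zero hα hα0
  have hNpos : 0 < N := Nat.pos_of_ne_zero hN0
  have hNC : (N : ℂ) ≠ 0 := by exact_mod_cast hN0
  have hNZ : (0 : ℤ) < N := by exact_mod_cast hNpos
  -- the box of division points
  let f : ℕ × ℕ → ℂ := fun ij => ((ij.1 : ℂ) * L.ω₁ + (ij.2 : ℂ) * L.ω₂) / N
  let box : Finset ℂ := ((Finset.range N) ×ˢ (Finset.range N)).image f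
  have hbox : ∀ c ∈ box, ∃ i j : ℕ, i < N ∧ j < N ∧ c = ((i : ℂ) * L.ω₁ + (j : ℂ) * L.ω₂) / N := by
    intro c hc
    obtain ⟨⟨i, j⟩, hij, rfl⟩ := Finset.mem_image.1 hc
    rw [Finset.mem_product, Finset.mem_range, Finset.mem_range] at hij
    exact ⟨i, j, hij.1, hij.2, rfl⟩
  refine ⟨box.filter (fun c => α * c ∈ L.lattice), ?_, ?_, ?_⟩
  · rw [Finset.mem_filter]
    refine ⟨Finset.mem_image.2 ⟨(0, 0), ?_, ?_⟩, by simp⟩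
    · simp [hNpos]
    · simp [f]
  · intro x
    constructor
    · intro hx
      have hNx : (N : ℂ) * x ∈ L.lattice := L.natCard_mul_mem_lattice_of_mul_mem hα hα0 hx
      obtain ⟨a, b, hab⟩ := mem_lattice.mp hNx
      set i := a % N with hi
      set j := b % N with hj
      have hi0 : 0 ≤ i := Int.emod_nonneg _ (by exact_mod_cast hN0)
      have hj0 : 0 ≤ j := Int.emod_nonneg _ (by exact_mod_cast hN0)
      have hiN : i < N := Int.emod_lt_of_pos _ hNZ
      have hjN : j < N := Int.emod_lt_of_pos _ hNZ
      have hic : ((i.toNat : ℕ) : ℤ) = i := Int.toNat_of_nonneg hi0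
      have hjc : ((j.toNat : ℕ) : ℤ) = j := Int.toNat_of_nonneg hj0
      set c : ℂ := ((i.toNat : ℂ) * L.ω₁ + (j.toNat : ℂ) * L.ω₂) / N with hc
      have hcbox : c ∈ box := by
        refine Finset.mem_image.2 ⟨(i.toNat, j.toNat), ?_, rfl⟩
        rw [Finset.mem_product, Finset.mem_range, Finset.mem_range]
        constructor <;> omega
      have hiC : ((i.toNat : ℕ) : ℂ) = (i : ℂ) := by
        rw [← Int.cast_natCast (R := ℂ) i.toNat, hic]
      have hjC : ((j.toNat : ℕ) : ℂ) = (j : ℂ) := by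
        rw [← Int.cast_natCast (R := ℂ) j.toNat, hjc]
      have hai : ((a / N : ℤ) : ℂ) * N = a - i := by
        have h := Int.emod_add_mul_ediv a N
        have h' : (i : ℂ) + ((N : ℤ) : ℂ) * ((a / N : ℤ) : ℂ) = a := by exact_mod_cast h
        push_cast at h'
        linear_combination h'
      have hbj : ((b / N : ℤ) : ℂ) * N = b - j := by
        have h := Int.emod_add_mul_ediv b N
        have h' : (j : ℂ) + ((N : ℤ) : ℂ) * ((b / N : ℤ) : ℂ) = b := by exact_mod_cast h
        push_cast at h'
        linear_combination h'
      have hxc : x - c ∈ L.lattice := by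
        refine mem_lattice.mpr ⟨a / N, b / N, ?_⟩
        rw [hc, hiC, hjC]
        field_simp
        linear_combination L.ω₁ * hai + L.ω₂ * hbj + hab
      refine ⟨c, Finset.mem_filter.2 ⟨hcbox, ?_⟩, hxc⟩
      have : α * c = α * x - α * (x - c) := by ring
      rw [this]
      exact sub_mem hx (hα _ hxc)
    · rintro ⟨c, hc, hxc⟩
      have hαc : α * c ∈ L.lattice := (Finset.mem_filter.1 hc).2
      have : α * x = α * (x - c) + α * c := by ring
      rw [this]
      exact add_mem (hα _ hxc) hαc
  · intro c hc c' hc' hcc'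
    obtain ⟨i, j, hi, hj, rfl⟩ := hbox c (Finset.mem_filter.1 hc).1
    obtain ⟨i', j', hi', hj', rfl⟩ := hbox c' (Finset.mem_filter.1 hc').1
    have h : ((((i : ℤ) - i' : ℤ) : ℂ) * L.ω₁ + (((j : ℤ) - j' : ℤ) : ℂ) * L.ω₂) / (N : ℕ) ∈
        L.lattice := by
      push_cast
      convert hcc' using 1
      ring
    obtain ⟨h1, h2⟩ := L.dvd_of_div_mem_lattice hNpos h
    have e1 : (i : ℤ) - i' = 0 := Int.eq_zero_of_abs_lt_dvd h1 (by rw [abs_sub_lt_iff]; omega)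
    have e2 : (j : ℤ) - j' = 0 := Int.eq_zero_of_abs_lt_dvd h2 (by rw [abs_sub_lt_iff]; omega)
    have ei : i = i' := by omega
    have ej : j = j' := by omega
    rw [ei, ej]

/-! ### The transformation formula for `α⁻¹Λ ⊇ Λ` -/

section Reps

variable {L}
variable {S : Finset ℂ}

/-- **`α²℘(αz) = Σ_{c ∈ S} ℘(z − c) − Σ_{c ∈ S, c ≠ 0} ℘(c)`** off `α⁻¹Λ`, for a system of
representatives `S ∋ 0` of `α⁻¹Λ/Λ`: the transformation of order `[Λ : αΛ]`
(`PeriodPair.weierstrassP_transformation`) for the lattice `α⁻¹Λ` and `℘_{α⁻¹Λ}(z) = α²℘_Λ(αz)`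
(homogeneity).  Cox, proof of Thm. 10.14, (ii) ⇒ (iii). [cite: Lawden1989, §9.8 eq. (9.8.14)] -/
theorem weierstrassP_mul_eq_sum_sub (hα0 : α ≠ 0) (hS0 : (0 : ℂ) ∈ S)
    (hS : ∀ x, α * x ∈ L.lattice ↔ ∃ c ∈ S, x - c ∈ L.lattice)
    (hSd : ∀ c ∈ S, ∀ c' ∈ S, c - c' ∈ L.lattice → c = c') {z : ℂ} (hz : α * z ∉ L.lattice) :
    α ^ 2 * ℘[L] (α * z) = ∑ c ∈ S, ℘[L] (z - c) - ∑ c ∈ S.erase 0, ℘[L] c := by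
  have hS' : ∀ x, x ∈ (L.mulLeft α⁻¹ (inv_ne_zero hα0)).lattice ↔ ∃ c ∈ S, x - c ∈ L.lattice :=
    fun x => by rw [mem_mulLeft_inv_lattice hα0]; exact hS x
  have hz' : z ∉ (L.mulLeft α⁻¹ (inv_ne_zero hα0)).lattice := by
    rwa [mem_mulLeft_inv_lattice hα0]
  have ht := weierstrassP_transformation hS' hS0 hSd hz'
  have hhom : ℘[L.mulLeft α⁻¹ (inv_ne_zero hα0)] z = α ^ 2 * ℘[L] (α * z) := by
    have h := weierstrassP_mulLeft α⁻¹ (inv_ne_zero hα0) L (α * z)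
    rw [← mul_assoc, inv_mul_cancel₀ hα0, one_mul] at h
    rw [h, inv_pow, inv_inv]
  rw [← hhom, ht]

/-- The sum `Σ_{c ∈ S} ℘(z − c)` over a system of representatives of `α⁻¹Λ/Λ` is even in `z`:
`Σ_c ℘(z + c) = Σ_c ℘(z − c)` off `α⁻¹Λ` (it is `α²℘(αz)` plus a constant). [folklore] -/
theorem sum_weierstrassP_add_eq (hα0 : α ≠ 0) (hS0 : (0 : ℂ) ∈ S)
    (hS : ∀ x, α * x ∈ L.lattice ↔ ∃ c ∈ S, x - c ∈ L.lattice)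
    (hSd : ∀ c ∈ S, ∀ c' ∈ S, c - c' ∈ L.lattice → c = c') {z : ℂ} (hz : α * z ∉ L.lattice) :
    ∑ c ∈ S, ℘[L] (z + c) = ∑ c ∈ S, ℘[L] (z - c) := by
  have hz' : α * -z ∉ L.lattice := by
    rw [mul_neg]
    exact fun h => hz (by simpa using neg_mem h)
  have h1 := weierstrassP_mul_eq_sum_sub hα0 hS0 hS hSd hz
  have h2 := weierstrassP_mul_eq_sum_sub hα0 hS0 hS hSd hz'
  rw [mul_neg, weierstrassP_neg] at h2
  have h3 : ∑ c ∈ S, ℘[L] (-z - c) = ∑ c ∈ S, ℘[L] (z + c) :=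
    Finset.sum_congr rfl fun c _ => by rw [show -z - c = -(z + c) by ring, weierstrassP_neg]
  rw [h3] at h2
  linear_combination h1 - h2

/-- For a representative `c` with `αc ∈ Λ` and `z ∉ α⁻¹Λ`: `z, c ± z ∉ Λ`-bookkeeping —
`℘(z) ≠ ℘(c)` when `c ∉ Λ`. [folklore] -/
lemma weierstrassP_ne_of_mul_notMem (hα : ∀ l ∈ L.lattice, α * l ∈ L.lattice) {z c : ℂ}
    (hz : α * z ∉ L.lattice) (hαc : α * c ∈ L.lattice) (hc : c ∉ L.lattice) :
    z ∉ L.lattice ∧ z - c ∉ L.lattice ∧ z + c ∉ L.lattice ∧ ℘[L] z ≠ ℘[L] c := by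
  have hzΛ : z ∉ L.lattice := fun h => hz (hα z h)
  have hzc : z - c ∉ L.lattice := fun h => hz (by
    have : α * z = α * (z - c) + α * c := by ring
    rw [this]; exact add_mem (hα _ h) hαc)
  have hzc' : z + c ∉ L.lattice := fun h => hz (by
    have : α * z = α * (z + c) - α * c := by ring
    rw [this]; exact sub_mem (hα _ h) hαc)
  refine ⟨hzΛ, hzc, hzc', fun h => ?_⟩
  rcases (L.weierstrassP_eq_weierstrassP_iff hzΛ hc).mp h with h' | h'
  · exact hzc' h'
  · exact hzc h'

end Reps

/-! ### `℘(αz)` is a rational function of `℘(z)` -/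

/-- **`℘(αz) = (P/Q)(℘(z))` for a complex multiplication `α`** (Cox, Thm. 10.14 (ii) ⇒ (iii):
"`℘(αz)` is a rational function in `℘(z)`"; Weber III § 114).  Explicitly, with `S ∋ 0` a system of
representatives of `α⁻¹Λ/Λ` and `e_c = ℘(c)`:
`Q = ∏_{c ≠ 0} (X − e_c)²` and `2α²·P/Q = 2X + Σ_{c ≠ 0} (2e_cX² + (2e_c² − g₂/2)X − (g₂e_c/2 + g₃))/(X − e_c)² − 2Σ_{c≠0} e_c`,
valid at every `z` with `αz ∉ Λ` (where `Q(℘ z) ≠ 0`).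
[cite: Cox2013, §10.B Thm. 10.14 (proof, (ii) ⇒ (iii))] -/
theorem exists_rationalMap_of_mul_mem (hα0 : α ≠ 0) (hα : ∀ l ∈ L.lattice, α * l ∈ L.lattice) :
    ∃ P Q : ℂ[X], Q ≠ 0 ∧ ∀ z : ℂ, α * z ∉ L.lattice →
      Q.eval (℘[L] z) ≠ 0 ∧ ℘[L] (α * z) = P.eval (℘[L] z) / Q.eval (℘[L] z) := by
  classical
  obtain ⟨S, hS0, hS, hSd⟩ := L.exists_reps_of_mul_mem hα0 hα
  set S' := S.erase 0 with hS'
  -- the representatives `c ≠ 0` are off `Λ` and satisfy `αc ∈ Λ`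
  have hαc : ∀ c ∈ S', α * c ∈ L.lattice := fun c hc =>
    (hS c).2 ⟨c, Finset.mem_of_mem_erase hc, by simp⟩
  have hcΛ : ∀ c ∈ S', c ∉ L.lattice := by
    intro c hc h
    have hc0 : c ≠ 0 := Finset.ne_of_mem_erase hc
    exact hc0 (hSd c (Finset.mem_of_mem_erase hc) 0 hS0 (by simpa using h))
  -- the polynomials
  set e : ℂ → ℂ := fun c => ℘[L] c with he
  set K : ℂ := ∑ c ∈ S', ℘[L] c with hK
  set Dc : ℂ → ℂ[X] := fun c => (X - C (e c)) ^ 2 with hDc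
  set Nc : ℂ → ℂ[X] := fun c =>
    C (2 * e c) * X ^ 2 + C (2 * e c ^ 2 - L.g₂ / 2) * X - C (L.g₂ * e c / 2 + L.g₃) with hNc
  set Q : ℂ[X] := ∏ c ∈ S', Dc c with hQ
  set P : ℂ[X] := C (α ^ 2)⁻¹ *
    (X * Q + C (1 / 2) * ∑ c ∈ S', Nc c * ∏ c' ∈ S'.erase c, Dc c' - C K * Q) with hP
  have hQ0 : Q ≠ 0 := by
    rw [hQ, Finset.prod_ne_zero_iff]
    intro c _
    exact pow_ne_zero 2 (X_sub_C_ne_zero (e c))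
  refine ⟨P, Q, hQ0, fun z hz => ?_⟩
  have hzΛ : z ∉ L.lattice := fun h => hz (hα z h)
  have hne : ∀ c ∈ S', ℘[L] z - e c ≠ 0 := fun c hc =>
    sub_ne_zero.2 (weierstrassP_ne_of_mul_notMem hα hz (hαc c hc) (hcΛ c hc)).2.2.2
  have hDcz : ∀ c ∈ S', (Dc c).eval (℘[L] z) ≠ 0 := fun c hc => by
    simp only [hDc, eval_pow, eval_sub, eval_X, eval_C]
    exact pow_ne_zero 2 (hne c hc)
  have hQz : Q.eval (℘[L] z) ≠ 0 := by
    rw [hQ, eval_prod, Finset.prod_ne_zero_iff]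
    exact hDcz
  refine ⟨hQz, ?_⟩
  -- the symmetrised transformation formula
  have key : 2 * α ^ 2 * ℘[L] (α * z) =
      2 * ℘[L] z + ∑ c ∈ S', (Nc c).eval (℘[L] z) / (Dc c).eval (℘[L] z) - 2 * K := by
    have h1 := weierstrassP_mul_eq_sum_sub hα0 hS0 hS hSd hz
    rw [← hS'] at h1
    have h2 := sum_weierstrassP_add_eq hα0 hS0 hS hSd hz
    have hsplit₁ : ∑ c ∈ S, ℘[L] (z - c) = ℘[L] z + ∑ c ∈ S', ℘[L] (z - c) := by
      rw [hS', ← Finset.add_sum_erase S _ hS0, sub_zero]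
    have hsplit₂ : ∑ c ∈ S, ℘[L] (z + c) = ℘[L] z + ∑ c ∈ S', ℘[L] (z + c) := by
      rw [hS', ← Finset.add_sum_erase S _ hS0, add_zero]
    have hsym : ∑ c ∈ S', (Nc c).eval (℘[L] z) / (Dc c).eval (℘[L] z) =
        ∑ c ∈ S', (℘[L] (z + c) + ℘[L] (z - c)) := by
      refine Finset.sum_congr rfl fun c hc => ?_
      obtain ⟨-, hzc, hzc', -⟩ := weierstrassP_ne_of_mul_notMem hα hz (hαc c hc) (hcΛ c hc)
      rw [L.weierstrassP_add_add_weierstrassP_sub hzΛ (hcΛ c hc) hzc hzc']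
      simp only [hNc, hDc, he, eval_add, eval_sub, eval_mul, eval_pow, eval_C, eval_X]
    rw [hsym, Finset.sum_add_distrib, hK]
    linear_combination 2 * h1 + hsplit₁ - h2 + hsplit₂
  -- evaluate `P/Q`
  have hfrac : ∀ c ∈ S', (Nc c).eval (℘[L] z) * ∏ c' ∈ S'.erase c, (Dc c').eval (℘[L] z) =
      (Nc c).eval (℘[L] z) / (Dc c).eval (℘[L] z) * Q.eval (℘[L] z) := by
    intro c hc
    have hQc : Q.eval (℘[L] z) =
        (Dc c).eval (℘[L] z) * ∏ c' ∈ S'.erase c, (Dc c').eval (℘[L] z) := by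
      rw [hQ, eval_prod, ← Finset.mul_prod_erase S' _ hc]
    rw [hQc, ← mul_assoc, div_mul_cancel₀ _ (hDcz c hc)]
  have hsum : ∑ c ∈ S', (Nc c).eval (℘[L] z) * ∏ c' ∈ S'.erase c, (Dc c').eval (℘[L] z) =
      (∑ c ∈ S', (Nc c).eval (℘[L] z) / (Dc c).eval (℘[L] z)) * Q.eval (℘[L] z) := by
    rw [Finset.sum_mul]
    exact Finset.sum_congr rfl hfrac
  have hPz : P.eval (℘[L] z) = (α ^ 2)⁻¹ * ((℘[L] z +
      1 / 2 * (∑ c ∈ S', (Nc c).eval (℘[L] z) / (Dc c).eval (℘[L] z)) - K) * Q.eval (℘[L] z)) := by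
    rw [hP]
    simp only [eval_mul, eval_add, eval_sub, eval_C, eval_X, eval_finsetSum, eval_prod]
    rw [hsum]
    ring
  rw [hPz, mul_div_assoc, mul_div_cancel_right₀ _ hQz]
  apply mul_left_cancel₀ (pow_ne_zero 2 hα0)
  rw [← mul_assoc, mul_inv_cancel₀ (pow_ne_zero 2 hα0), one_mul]
  linear_combination key / 2

/-! ### From the rational map to the polynomial identities `(H1)`, `(H2)` -/

/-- A polynomial vanishing at `℘(z)` for every `z` with `αz ∉ Λ` is zero: `℘` takes all complex
values off `Λ`, while the excluded `z` form the countable set `α⁻¹Λ`. [folklore] -/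
lemma eq_zero_of_eval_weierstrassP_eq_zero (hα0 : α ≠ 0) {R : ℂ[X]}
    (hR : ∀ z, α * z ∉ L.lattice → R.eval (℘[L] z) = 0) : R = 0 := by
  classical
  by_contra hR0
  have hΛc : (L.lattice : Set ℂ).Countable := by
    have : (L.lattice : Set ℂ) ⊆ Set.range (fun p : ℤ × ℤ => (p.1 : ℂ) * L.ω₁ + (p.2 : ℂ) * L.ω₂) := by
      intro x hx
      obtain ⟨m, n, h⟩ := mem_lattice.mp hx
      exact ⟨(m, n), h⟩
    exact (Set.countable_range _).mono this
  have hbad₁ : ((fun z => ℘[L] z) '' {z | α * z ∈ L.lattice}).Countable := by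
    refine Set.Countable.image ?_ _
    have : {z : ℂ | α * z ∈ L.lattice} ⊆ (fun l => α⁻¹ * l) '' (L.lattice : Set ℂ) := by
      intro z hz
      exact ⟨α * z, hz, by simp [← mul_assoc, inv_mul_cancel₀ hα0]⟩
    exact (hΛc.image _).mono this
  have hbad : (((R.roots.toFinset : Finset ℂ) : Set ℂ) ∪
      (fun z => ℘[L] z) '' {z | α * z ∈ L.lattice}).Countable :=
    (Finset.countable_toSet _).union hbad₁
  obtain ⟨x₀, hx₀⟩ : ∃ x₀, x₀ ∉ ((R.roots.toFinset : Finset ℂ) : Set ℂ) ∪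
      (fun z => ℘[L] z) '' {z | α * z ∈ L.lattice} := by
    by_contra! hall
    exact not_countable_complex (hbad.mono fun x _ => hall x)
  obtain ⟨z₀, hz₀Λ, hz₀x⟩ := L.exists_weierstrassP_eq x₀
  have hαz₀ : α * z₀ ∉ L.lattice := fun h => hx₀ (Or.inr ⟨z₀, h, hz₀x⟩)
  have h0 := hR z₀ hαz₀
  rw [hz₀x] at h0
  exact hx₀ (Or.inl (by
    rw [Finset.mem_coe, Multiset.mem_toFinset, mem_roots hR0]
    exact h0))

/-- **The transformation identities `(H1)`, `(H2)` of a rational transformation of `℘`.**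
If `α ≠ 0`, `αΛ ⊆ Λ` and `℘(αz) = P(℘ z)/Q(℘ z)` (with `Q(℘ z) ≠ 0`) for all `z` with `αz ∉ Λ`,
then `(H1)` `f·(P'Q − PQ')² = α²(4P³ − g₂PQ² − g₃Q³)Q` and
`(H2)` `2[(P''Q − PQ'')Q − 2Q'(P'Q − PQ')]f + (P'Q − PQ')Q(12X² − g₂) = α²(12P²Q − g₂Q³)` hold in
`ℂ[X]`: differentiate `u = ℘(α·) = (P/Q)(℘)` once (`u' = α℘'(αz) = (P'Q − PQ')(℘)℘'/Q(℘)²`, so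
`u'² = α²f(u)`) and twice (`u'' = α²℘''(αz) = α²(6u² − g₂/2)`), clear denominators using
`℘'² = f(℘)`, and use that `℘` takes all but countably many values off `α⁻¹Λ`
(Weber III §§ 114–115; the identities consumed by `PeriodPair.mul_mem_lattice_of_transformation`).
[folklore] -/
theorem transformation_identities_of_rationalMap (hα0 : α ≠ 0)
    (hα : ∀ l ∈ L.lattice, α * l ∈ L.lattice) {P Q : ℂ[X]}
    (h : ∀ z : ℂ, α * z ∉ L.lattice →
      Q.eval (℘[L] z) ≠ 0 ∧ ℘[L] (α * z) = P.eval (℘[L] z) / Q.eval (℘[L] z)) :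
    (C 4 * X ^ 3 - C L.g₂ * X - C L.g₃) * (derivative P * Q - P * derivative Q) ^ 2 =
      C (α ^ 2) * ((C 4 * P ^ 3 - C L.g₂ * P * Q ^ 2 - C L.g₃ * Q ^ 3) * Q) ∧
    C 2 * ((((derivative (derivative P)) * Q - P * derivative (derivative Q)) * Q -
        C 2 * (derivative Q * (derivative P * Q - P * derivative Q))) *
        (C 4 * X ^ 3 - C L.g₂ * X - C L.g₃)) +
      (derivative P * Q - P * derivative Q) * Q * (C 12 * X ^ 2 - C L.g₂) =
      C (α ^ 2) * (C 12 * P ^ 2 * Q - C L.g₂ * Q ^ 3) := by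
  set U : Set ℂ := {z | α * z ∉ L.lattice} with hU
  have hUopen : IsOpen U :=
    (continuous_const.mul continuous_id).isOpen_preimage _ L.isClosed_lattice.isOpen_compl
  have hUΛ : ∀ z ∈ U, z ∉ L.lattice := fun z hz hzΛ => hz (hα z hzΛ)
  have hlin : ∀ z : ℂ, HasDerivAt (fun w : ℂ => α * w) α z := fun z => by
    simpa using (hasDerivAt_id z).const_mul α
  -- the first derivative: `α ℘'(αz) = D(℘ z) ℘'(z) / Q(℘ z)²` on `U`
  have hD1 : ∀ z ∈ U, α * ℘'[L] (α * z) =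
      (derivative P * Q - P * derivative Q).eval (℘[L] z) * ℘'[L] z / Q.eval (℘[L] z) ^ 2 := by
    intro z hz
    have hzΛ := hUΛ z hz
    obtain ⟨hQz, -⟩ := h z hz
    have hv : HasDerivAt (fun w => ℘[L] (α * w)) (℘'[L] (α * z) * α) z :=
      (hasDerivAt_weierstrassP hz).comp z (hlin z)
    have hu := hasDerivAt_rationalMap_weierstrassP (P := P) (Q := Q) hzΛ hQz
    have hev : (fun w => ℘[L] (α * w)) =ᶠ[𝓝 z] fun w => P.eval (℘[L] w) / Q.eval (℘[L] w) := by
      filter_upwards [hUopen.mem_nhds hz] with w hw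
      exact (h w hw).2
    have hu' := hu.congr_of_eventuallyEq hev
    have := hv.unique hu'
    rw [← this, mul_comm]
  -- the second derivative on `U`
  have hD2 : ∀ z ∈ U,
      (((derivative (derivative P * Q - P * derivative Q)).eval (℘[L] z) * ℘'[L] z * ℘'[L] z +
        (derivative P * Q - P * derivative Q).eval (℘[L] z) * (6 * ℘[L] z ^ 2 - L.g₂ / 2)) *
          Q.eval (℘[L] z) ^ 2 -
        (derivative P * Q - P * derivative Q).eval (℘[L] z) * ℘'[L] z *
          (2 * Q.eval (℘[L] z) * ((derivative Q).eval (℘[L] z) * ℘'[L] z))) /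
        (Q.eval (℘[L] z) ^ 2) ^ 2 = α * ((6 * ℘[L] (α * z) ^ 2 - L.g₂ / 2) * α) := by
    intro z hz
    have hzΛ := hUΛ z hz
    obtain ⟨hQz, -⟩ := h z hz
    have hv : HasDerivAt (fun w => α * ℘'[L] (α * w)) (α * ((6 * ℘[L] (α * z) ^ 2 - L.g₂ / 2) * α)) z :=
      ((L.hasDerivAt_derivWeierstrassP hz).comp z (hlin z)).const_mul α
    have hu := hasDerivAt_rationalMap_weierstrassP_deriv (P := P) (Q := Q) hzΛ hQz
    have hev : (fun w => α * ℘'[L] (α * w)) =ᶠ[𝓝 z] fun w =>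
        (derivative P * Q - P * derivative Q).eval (℘[L] w) * ℘'[L] w / Q.eval (℘[L] w) ^ 2 := by
      filter_upwards [hUopen.mem_nhds hz] with w hw
      exact hD1 w hw
    have hu' := hu.congr_of_eventuallyEq hev
    exact (hu'.unique hv)
  constructor
  · -- (H1)
    rw [← sub_eq_zero]
    apply L.eq_zero_of_eval_weierstrassP_eq_zero hα0
    intro z hz
    have hzΛ := hUΛ z hz
    obtain ⟨hQz, heq⟩ := h z hz
    have hsq := L.derivWeierstrassP_sq (α * z) hz
    have hsqz := L.derivWeierstrassP_sq z hzΛ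
    have hd := hD1 z hz
    rw [heq] at hsq
    simp only [eval_sub, eval_mul, eval_pow, eval_C, eval_X]
    set x := ℘[L] z with hx
    set y := ℘'[L] z with hy
    set y' := ℘'[L] (α * z) with hy'
    set p := P.eval x with hp
    set q := Q.eval x with hq
    set d := (derivative P * Q - P * derivative Q).eval x with hdd
    have hd' : α * y' * q ^ 2 = d * y := by
      rw [hd, div_mul_cancel₀ _ (pow_ne_zero 2 hQz)]
    have hpq3 : (p / q) ^ 3 * q ^ 3 = p ^ 3 := by
      rw [div_pow, div_mul_cancel₀ _ (pow_ne_zero 3 hQz)]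
    have hpq1 : p / q * q ^ 3 = p * q ^ 2 := by
      rw [show q ^ 3 = q * q ^ 2 by ring, ← mul_assoc, div_mul_cancel₀ _ hQz]
    have e3 : y' ^ 2 * q ^ 3 = 4 * p ^ 3 - L.g₂ * p * q ^ 2 - L.g₃ * q ^ 3 := by
      rw [hsq]
      linear_combination 4 * hpq3 - L.g₂ * hpq1
    have hdd' : d = (derivative P).eval x * q - p * (derivative Q).eval x := by
      simp [hdd, hp, hq, eval_sub, eval_mul]
    rw [← hdd']
    linear_combination (α ^ 2 * q) * e3 - d ^ 2 * hsqz - (α * y' * q ^ 2 + d * y) * hd'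
  · -- (H2)
    rw [← sub_eq_zero]
    apply L.eq_zero_of_eval_weierstrassP_eq_zero hα0
    intro z hz
    have hzΛ := hUΛ z hz
    obtain ⟨hQz, heq⟩ := h z hz
    have hsqz := L.derivWeierstrassP_sq z hzΛ
    have hW := hD2 z hz
    rw [heq] at hW
    have hD' : (derivative (derivative P * Q - P * derivative Q)).eval (℘[L] z) =
        (derivative (derivative P)).eval (℘[L] z) * Q.eval (℘[L] z) -
          P.eval (℘[L] z) * (derivative (derivative Q)).eval (℘[L] z) := by
      simp only [derivative_sub, derivative_mul, eval_sub, eval_add, eval_mul]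
      ring
    rw [hD'] at hW
    simp only [eval_sub, eval_mul, eval_add, eval_pow, eval_C, eval_X]
    simp only [eval_sub, eval_mul] at hW
    set x := ℘[L] z with hx
    set y := ℘'[L] z with hy
    set p := P.eval x with hp
    set q := Q.eval x with hq
    set p₁ := (derivative P).eval x with hp₁
    set q₁ := (derivative Q).eval x with hq₁
    set p₂ := (derivative (derivative P)).eval x with hp₂
    set q₂ := (derivative (derivative Q)).eval x with hq₂
    have hq4 : (q ^ 2) ^ 2 ≠ 0 := pow_ne_zero 2 (pow_ne_zero 2 hQz)
    have hW' : ((p₂ * q - p * q₂) * y * y + (p₁ * q - p * q₁) * (6 * x ^ 2 - L.g₂ / 2)) * q ^ 2 -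
        (p₁ * q - p * q₁) * y * (2 * q * (q₁ * y)) =
        α ^ 2 * (6 * p ^ 2 * q ^ 2 - L.g₂ / 2 * q ^ 4) := by
      rw [div_eq_iff hq4] at hW
      rw [hW]
      have hpq : (p / q) ^ 2 * (q ^ 2) ^ 2 = p ^ 2 * q ^ 2 := by
        rw [div_pow, show (q ^ 2) ^ 2 = q ^ 2 * q ^ 2 by ring, ← mul_assoc,
          div_mul_cancel₀ _ (pow_ne_zero 2 hQz)]
      linear_combination α ^ 2 * 6 * hpq
    have : (2 * (((p₂ * q - p * q₂) * q - 2 * (q₁ * (p₁ * q - p * q₁))) *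
        (4 * x ^ 3 - L.g₂ * x - L.g₃)) + (p₁ * q - p * q₁) * q * (12 * x ^ 2 - L.g₂) -
        α ^ 2 * (12 * p ^ 2 * q - L.g₂ * q ^ 3)) * q = 0 := by
      linear_combination 2 * hW' - 2 * ((p₂ * q - p * q₂) * q ^ 2 -
        2 * (p₁ * q - p * q₁) * q * q₁) * hsqz
    exact (mul_eq_zero.1 this).resolve_right hQz

/-! ### The main theorem -/

/-- **Transformation polynomials of a complex multiplication** (Cox, *Primes of the form
x² + ny²*, Thm. 10.14 (ii) ⇒ (iii), in the polynomial form of `LatticeEndomorphism.lean`; Weber,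
*Lehrbuch der Algebra* III §§ 114–115).  If `α ≠ 0` and `αΛ ⊆ Λ`, there are `P, Q ∈ ℂ[X]`,
`Q ≠ 0`, with
`(H1)` `f·(P'Q − PQ')² = α²(4P³ − g₂PQ² − g₃Q³)Q` and
`(H2)` `2[(P''Q − PQ'')Q − 2Q'(P'Q − PQ')]f + (P'Q − PQ')Q(12X² − g₂) = α²(12P²Q − g₂Q³)`,
`f = 4X³ − g₂(Λ)X − g₃(Λ)` — namely the pair with `℘_Λ(αz) = (P/Q)(℘_Λ(z))`.  Together with
`PeriodPair.mul_mem_lattice_of_transformation` this characterises complex multiplication by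
polynomial identities in the data `(α, g₂, g₃, P, Q)`.
[cite: Cox2013, §10.B Thm. 10.14 ((ii) ⇒ (iii)) and §10.C (10.24)] -/
theorem exists_transformation_of_mul_mem_lattice (hα0 : α ≠ 0)
    (hα : ∀ l ∈ L.lattice, α * l ∈ L.lattice) :
    ∃ P Q : ℂ[X], Q ≠ 0 ∧
      (C 4 * X ^ 3 - C L.g₂ * X - C L.g₃) * (derivative P * Q - P * derivative Q) ^ 2 =
        C (α ^ 2) * ((C 4 * P ^ 3 - C L.g₂ * P * Q ^ 2 - C L.g₃ * Q ^ 3) * Q) ∧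
      C 2 * ((((derivative (derivative P)) * Q - P * derivative (derivative Q)) * Q -
          C 2 * (derivative Q * (derivative P * Q - P * derivative Q))) *
          (C 4 * X ^ 3 - C L.g₂ * X - C L.g₃)) +
        (derivative P * Q - P * derivative Q) * Q * (C 12 * X ^ 2 - C L.g₂) =
        C (α ^ 2) * (C 12 * P ^ 2 * Q - C L.g₂ * Q ^ 3) := by
  obtain ⟨P, Q, hQ0, h⟩ := L.exists_rationalMap_of_mul_mem hα0 hα
  exact ⟨P, Q, hQ0, L.transformation_identities_of_rationalMap hα0 hα h⟩

end PeriodPair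

end
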